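import Summits.BirchSwinnertonDyer.BirchSwinnertonDyer.Theorems.SignedLowerHalvesKobayashiLowerHalfLargeImageTwistToLocus
import Summits.BirchSwinnertonDyer.Rank1Residual.AdditivePotMult.PStarTwistModel
import Summits.BirchSwinnertonDyer.Rank1Residual.AdditivePotMult.QuadraticTwistRamifiedPotMult
import Summits.BirchSwinnertonDyer.Rank1Residual.AdditivePotMult.TwistSupplyJ
import Summits.BirchSwinnertonDyer.Rank1Residual.EisensteinPrimes
import HarnessLib

/-!
# Route `SignedLowerHalves`, crux `KobayashiLowerHalfLargeImage` (item stmt-BirchSwinnertonDyer-19001):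
# TWIST-TO-LOCUS THROUGH A POTENTIALLY MULTIPLICATIVE PRIME — the reach of «one quadratic twist from
# the Fouquet–Wan locus» is the tree's `j`-WITNESS condition (cell `bsd-ssimc`, seat `bsd-ssimc-k3-c3`
# gen 4; a `--supports … --as helper` file, closes nothing). Companion of `…LargeImageTwistToLocus.lean`
# (p430776 + p432609) and `…LargeImageOffLocusRam.lean` (p433235).

PARTITION (cell bsd-ssimc): X7 (A7) × the 23 off-FW-locus large-image window pairs WITHOUT a (ram)
prime (pieces D ∪ E of MEMO-3 §T, «shapeless» in MEMO-4 F.1): 11 of them carry an ODD `j`-witness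
`r ≠ p` (`ord_r j(E) < 0`, `p ∤ ord_r j(E)`; `r` an additive, potentially multiplicative prime), 2 only a
dyadic one, 10 none — types-the-object-of; closes NONE. THEOREMS ONLY; no definition, no new named
fact; nothing about any curve is asserted; FW stays PRE; BSD is not proved by any of this.

## What this file records (namespace `Summit.BirchSwinnertonDyer.BirchSwinnertonDyer.Theorems`)

Gen 3 proved: an X7 large-image curve with a SPLIT `ρ̄`-ramified multiplicative prime `ℓ ≠ p` is one
prime quadratic twist away from the Fouquet–Wan locus of the registered stub `stub_fwLocus` (a prime
`ℓ ≠ p` of NON-split multiplicative reduction with `p ∤ ord_ℓ Δ_min`). The same holds when the witness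
prime is ADDITIVE and potentially multiplicative: if `r ∉ {2, p}` is a prime with `PotMult W r`
(`Addv W r ∧ ord_r j(W) < 0`, Kodaira `I_n^*`, `n = −ord_r j(W)`) and `p ∤ ord_r j(W)`, then the
twist `W^{(r*)}`, `r* = (−1)^{⌊r/2⌋} r`, is MULTIPLICATIVE at `r` with `ord_r Δ_min = n` (tree
`AdditivePotMult.PotMult.exists_mult_pStar_twist_model`, Silverman *ATAEC* V.5.3, and
`padicValRat_j_eq_neg_of_mult`), and one further unit twist by a Dirichlet prime `q` in the right class
mod `r` makes (or keeps) it NON-split (`nonsplit_of_smul_eq_quadraticTwist_of_not_isSquare` of gen 3 /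
`nonsplit_of_smul_eq_quadraticTwist_of_isSquare_of_nonsplit` here). The globally minimal models `W'` of
`W^{(r*·q)}` are X7 pairs at `p` with `a_p = 0`, `ρ̄` onto, no CM (transport along the square-free twist
`r*·q`, `p ∤ 2 r q`; additivity at `q`) and lie ON the locus at `r`:
`exists_twist_on_fwLocus_of_potMult` (a THEOREM, no binder). In the tree's `j`-witness currency
(`AdditivePotMult/TwistSupplyJ.lean`, `GaloisImage/JWitnessTowerSurjectivity.lean`) the two cases
merge: `exists_twist_on_fwLocus_of_offFwLocus_of_jWitness_odd` — the registered `stub_offFwLocus`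
hypotheses verbatim + an ODD `j`-witness ⟹ a quadratic twist on the locus; and conversely NO twist of a
curve WITHOUT a `j`-witness is on the locus (`not_fwLocus_model_twist_of_forall_dvd`, from the tree's
`not_ram_model_twist_of_forall_dvd`). Modulo the FW binder the twist satisfies Kobayashi's main
conjecture, both signs (`exists_twist_kobayashiMainConjecture_of_thm451_OPEN_of_potMult`, CONDITIONAL).

Reading (MEMO-5 of this seat): «one quadratic twist from the FW locus» ⟺ «a `j`-witness» (odd
witnesses in the kernel; the dyadic potentially-multiplicative witness is not treated here). Off the
locus the missing input is still TWIST DESCENT (not claimed, not typed); for the curves with no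
`j`-witness at all (window: 10 pairs) no quadratic twist has a `ρ̄`-ramified Steinberg prime `≠ p`, so
no (ram)-based engine (FW; BSTW II §2.3; the hybrid of MEMO-4 F.2) starts on any twist.

References: [FouquetWan2021] Thm 4.51 / 1.13 (PRE); [Kobayashi2003] Thm. 7.4, Conjecture (p. 2);
[SilvermanAEC2009] VII.5 Prop. 5.1, X.5 Cor. 5.4, VIII.8 Cor. 8.3; [SilvermanATAEC1994] V.5.3;
cell memos k3-c3 MEMO-3 §T, MEMO-4 §F, MEMO-5 (this gen).
-/

set_option autoImplicit false
set_option linter.dupNamespace false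

noncomputable section

open scoped Classical

open WeierstrassCurve IsDedekindDomain NumberField Rat.HeightOneSpectrum
  Literature.NumberTheory.EllipticCurves
  Literature.NumberTheory.EllipticCurves.Rank1Residual
  Summit.BirchSwinnertonDyer.Rank1Residual.Supersingular

namespace Summit.BirchSwinnertonDyer.BirchSwinnertonDyer.Theorems

/-! ### §5 The unit twist at a NON-split multiplicative place by a square residue stays non-split -/

section LocalNonsplit

variable (W W' : WeierstrassCurve ℚ) [W.IsElliptic] [W.IsGloballyMinimal] [W'.IsElliptic]
  [W'.IsGloballyMinimal]

/-- **Local part, non-split case.** Let `C • W' = W^{(d)}` with `W, W'` globally minimal, `ℓ` an ODD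
prime with `ℓ ∤ d` at which `W` has NON-SPLIT multiplicative reduction, and `d` a quadratic RESIDUE
mod `ℓ`. Then `W'` has NON-SPLIT multiplicative reduction at `ℓ` and `ord_ℓ Δ_min(W') = ord_ℓ Δ_min(W)`
(the unit twist at an odd multiplicative place keeps the type and `ord Δ_min`, and is split iff
`(d/ℓ) = 1 ⟺ W` split: `AdditivePotMult.hasMultiplicativeReductionAt_and_split_iff_quadraticTwist_of_not_dvd`;
all three are `ℚ`-isomorphism invariants). Twin of gen 3's
`nonsplit_of_smul_eq_quadraticTwist_of_not_isSquare`. [cite: SilvermanAEC2009, VII.5 Prop. 5.1(b) and X.5 Cor. 5.4] -/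
theorem nonsplit_of_smul_eq_quadraticTwist_of_isSquare_of_nonsplit {d : ℤ} {C : VariableChange ℚ}
    (hC : C • W' = W.quadraticTwist (d : ℚ)) (ℓ : ℕ) [Fact ℓ.Prime] (hℓ2 : ℓ ≠ 2)
    (hℓd : ¬ (ℓ : ℤ) ∣ d) (hsq : IsSquare ((d : ℤ) : ZMod ℓ))
    (hmult : W.HasMultiplicativeReductionAtPrime ℓ)
    (hns : ¬ W.HasSplitMultiplicativeReductionAtPrime ℓ) :
    W'.HasMultiplicativeReductionAtPrime ℓ ∧ ¬ W'.HasSplitMultiplicativeReductionAtPrime ℓ ∧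
      padicValInt ℓ W'.minimalDiscriminantInt = padicValInt ℓ W.minimalDiscriminantInt := by
  have hd0 : (d : ℚ) ≠ 0 := by
    have : d ≠ 0 := fun h ↦ hℓd (by rw [h]; exact dvd_zero _)
    exact_mod_cast this
  haveI := W.isElliptic_quadraticTwist hd0
  obtain ⟨v, rfl⟩ : ∃ v : HeightOneSpectrum (𝓞 ℚ), ((primesEquiv v : ℕ)) = ℓ :=
    ⟨primesEquiv.symm ⟨ℓ, Fact.out⟩, by rw [Equiv.apply_symm_apply]⟩
  have hWv : W.HasMultiplicativeReductionAt v :=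
    (hasMultiplicativeReductionAtPrime_iff_hasMultiplicativeReductionAt_ringOfIntegers W v).mp hmult
  obtain ⟨-, hTord, hTs⟩ :=
    Summit.BirchSwinnertonDyer.Rank1Residual.AdditivePotMult.hasMultiplicativeReductionAt_and_split_iff_quadraticTwist_of_not_dvd
      W v hℓ2 hℓd hWv
  have hW' : W' = C⁻¹ • W.quadraticTwist (d : ℚ) := by rw [← hC, inv_smul_smul]
  refine ⟨Summit.BirchSwinnertonDyer.Rank1Residual.X2.hasMultiplicativeReductionAtPrime_of_smul_eq_quadraticTwist
      W W' hC _ hℓ2 hℓd hmult, ?_, ?_⟩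
  · intro h'
    have h1 : W'.HasSplitMultiplicativeReductionAt v :=
      (hasSplitMultiplicativeReductionAtPrime_iff_hasSplitMultiplicativeReductionAt W' v).mp h'
    rw [hW', hasSplitMultiplicativeReductionAt_smul_iff_holds v _ C⁻¹] at h1
    exact hns ((hasSplitMultiplicativeReductionAtPrime_iff_hasSplitMultiplicativeReductionAt W v).mpr
      ((hTs.mp h1).mp hsq))
  · rw [← LocalTorsionMult.ordMinimalDiscriminant_eq_padicValInt W' v rfl,
      ← LocalTorsionMult.ordMinimalDiscriminant_eq_padicValInt W v rfl, hW',
      ordMinimalDiscriminant_smul_holds v _ C⁻¹, hTord]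

end LocalNonsplit

/-! ### §6 Twist-to-locus through a potentially multiplicative prime -/

section PotMultTwist

variable (W : WeierstrassCurve ℚ) [W.IsElliptic] [W.IsGloballyMinimal]

/-- `r q` is square-free for distinct primes `r, q`, and so is `± r q`. [folklore] -/
theorem squarefree_pStar_mul_prime {r q : ℕ} (hr : r.Prime) (hq : q.Prime) (hrq : q ≠ r) :
    Squarefree ((-1 : ℤ) ^ (r / 2) * r * q) := by
  rw [← Int.squarefree_natAbs]
  have habs : ((-1 : ℤ) ^ (r / 2) * r * q).natAbs = r * q := by
    rw [Int.natAbs_mul, Int.natAbs_mul, Int.natAbs_pow, Int.natAbs_neg, Int.natAbs_one, one_pow,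
      one_mul, Int.natAbs_natCast, Int.natAbs_natCast]
  rw [habs, Nat.squarefree_mul ((Nat.coprime_primes hr hq).mpr (Ne.symm hrq))]
  exact ⟨hr.squarefree, hq.squarefree⟩

/-- **Twist-to-locus through a potentially multiplicative prime.** Let `W` be a globally minimal X7
pair at the odd prime `p` with `a_p = 0`, `ρ̄_{E,p}` onto and no CM, and let `r ∉ {2, p}` be a prime of
ADDITIVE, POTENTIALLY MULTIPLICATIVE reduction (`PotMult W r`: additive at `r`, `ord_r j < 0`) with
`p ∤ ord_r j(W)`. Then there are a prime `q ∉ {2, p, r}` and a globally minimal model `W'` of the twist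
`W^{(r*·q)}`, `r* = (−1)^{⌊r/2⌋} r`, which is an X7 pair at `p` with `a_p = 0`, `ρ̄` onto, no CM, and
lies ON the Fouquet–Wan locus AT `r`: non-split multiplicative at `r` with
`ord_r Δ_min(W') = −ord_r j(W)`, prime to `p`. Steps: `W ≅ V^{(r*)}` with `V` globally minimal and
MULTIPLICATIVE at `r` (`PotMult.exists_mult_pStar_twist_model`); `ord_r Δ_min(V) = −ord_r j(V) =
−ord_r j(W)` (`dvd_padicValInt_minimalDiscriminantInt_iff_of_mult`, `j` a twist invariant); a Dirichlet
prime `q` (`Nat.forall_exists_prime_gt_and_eq_mod`) in a NON-square class mod `r` if `V` is split at `r`,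
in the class of `1` if not, beyond `2 + p + r + |Δ_min(W)| + |Δ_min(V)|`; `W'` a globally minimal model of
`V^{(q)} ≅ W^{(r*·q)}` (`quadraticTwist_smul`, `quadraticTwist_quadraticTwist`); the unit twist at `r`
is multiplicative, NON-split, same `ord_r Δ_min` (§4 of gen 3 / §5); X7 ∧ `a_p = 0` ∧ onto ∧ no CM along
the square-free twist `r*·q` with `p ∤ 2 r q` (`TwistStability`, additivity at `q`,
`hasSurjectiveModNGaloisRep_pow_iff_of_model_twist`, same `j`). A THEOREM; nothing about Kobayashi's
conjecture is asserted. [cite: SilvermanATAEC1994, V.5.3] [cite: SilvermanAEC2009, VII.5 Prop. 5.1(b), X.5 Cor. 5.4 and VIII.8 Cor. 8.3] -/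
theorem exists_twist_on_fwLocus_of_potMult (p : ℕ) [Fact p.Prime] (hp : p ≠ 2)
    (hX : ClassX7 W p) (hcm : ¬ W.HasCM) (hap : W.frobeniusTrace p = 0) (hs : Surj W p)
    {r : ℕ} [Fact r.Prime] (hr2 : r ≠ 2) (hrp : r ≠ p)
    (hpm : Summit.BirchSwinnertonDyer.Rank1Residual.AdditivePotMult.PotMult W r)
    (hj : ¬ (p : ℤ) ∣ padicValRat r W.j) :
    ∃ (q : ℕ) (_ : Fact q.Prime) (W' : WeierstrassCurve ℚ) (_ : W'.IsElliptic) (_ : W'.IsGloballyMinimal)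
      (C : VariableChange ℚ), q ≠ 2 ∧ q ≠ p ∧ q ≠ r ∧
      C • W' = W.quadraticTwist ((((-1 : ℤ) ^ (r / 2) * r * q : ℤ)) : ℚ) ∧
      ClassX7 W' p ∧ ¬ W'.HasCM ∧ W'.frobeniusTrace p = 0 ∧ Surj W' p ∧
      (r ≠ p ∧ W'.HasMultiplicativeReductionAtPrime r ∧ ¬ W'.HasSplitMultiplicativeReductionAtPrime r ∧
        ¬ p ∣ padicValInt r W'.minimalDiscriminantInt) := by
  have hpP : p.Prime := Fact.out
  have hrP : r.Prime := Fact.out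
  haveI : NeZero (2 : ℚ) := ⟨two_ne_zero⟩
  -- the `r*`-twist model `V`, multiplicative at `r`, with `C₀ • V^{(r*)} = W`
  set ps : ℚ := (-1 : ℚ) ^ (r / 2) * r with hps
  have hps0 : ps ≠ 0 :=
    mul_ne_zero (pow_ne_zero _ (by norm_num)) (Nat.cast_ne_zero.mpr hrP.ne_zero)
  obtain ⟨V, iV, iVm, C₀, hVm, hC₀⟩ := hpm.exists_mult_pStar_twist_model hr2
  -- `V = C₁ • W^{(r*)}`
  obtain ⟨C₁, hC₁⟩ :=
    Summit.BirchSwinnertonDyer.Rank1Residual.AdditivePotMult.exists_variableChange_smul_eq_of_smul_quadraticTwist_eq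
      V W hps0 hC₀
  have hC₁' : C₁⁻¹ • V = W.quadraticTwist ps := by rw [hC₁, inv_smul_smul]
  -- `ord_r Δ_min(V)` is prime to `p`: `j(V) = j(W)` and `ord_r Δ_min(V) = -ord_r j(V)`
  have hjV : V.j = W.j := j_eq_of_model_smul_eq_quadraticTwist hps0 hC₁'
  have hordV : ¬ p ∣ padicValInt r V.minimalDiscriminantInt := by
    rw [Summit.BirchSwinnertonDyer.Rank1Residual.AdditivePotMult.dvd_padicValInt_minimalDiscriminantInt_iff_of_mult
      V r hVm p, hjV]
    exact hj
  -- the residue class mod `r` of the auxiliary prime, and the local conclusion it buys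
  haveI : NeZero r := ⟨hrP.ne_zero⟩
  obtain ⟨a, hau, ha0, hloc⟩ : ∃ a : ZMod r, IsUnit a ∧ a ≠ 0 ∧
      ∀ (q : ℕ), ((q : ℤ) : ZMod r) = a → ¬ (r : ℤ) ∣ (q : ℤ) →
        ∀ (W' : WeierstrassCurve ℚ) [W'.IsElliptic] [W'.IsGloballyMinimal] (C : VariableChange ℚ),
          C • W' = V.quadraticTwist ((q : ℤ) : ℚ) →
          W'.HasMultiplicativeReductionAtPrime r ∧ ¬ W'.HasSplitMultiplicativeReductionAtPrime r ∧
            padicValInt r W'.minimalDiscriminantInt = padicValInt r V.minimalDiscriminantInt := by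
    by_cases hVs : V.HasSplitMultiplicativeReductionAtPrime r
    · have hchar : ringChar (ZMod r) ≠ 2 := by rw [ZMod.ringChar_zmod_n]; exact hr2
      obtain ⟨a, ha⟩ := FiniteField.exists_nonsquare hchar
      have ha0 : a ≠ 0 := by rintro rfl; exact ha IsSquare.zero
      refine ⟨a, isUnit_iff_ne_zero.mpr ha0, ha0, fun q hqa hrq W' _ _ C hC ↦ ?_⟩
      have hns : ¬ IsSquare (((q : ℤ) : ℤ) : ZMod r) := by rw [hqa]; exact ha
      exact nonsplit_of_smul_eq_quadraticTwist_of_not_isSquare V W' hC r hr2 hrq hns hVm hVs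
    · refine ⟨1, isUnit_one, one_ne_zero, fun q hqa hrq W' _ _ C hC ↦ ?_⟩
      have hsq : IsSquare (((q : ℤ) : ℤ) : ZMod r) := by rw [hqa]; exact IsSquare.one
      exact nonsplit_of_smul_eq_quadraticTwist_of_isSquare_of_nonsplit V W' hC r hr2 hrq hsq hVm hVs
  -- Dirichlet: a prime `q ≡ a (mod r)` beyond `2`, `p`, `r`, `|Δ_min(W)|`, `|Δ_min(V)|`
  obtain ⟨q, hqgt, hqP, hqa⟩ := Nat.forall_exists_prime_gt_and_eq_mod hau
    (2 + p + r + W.minimalDiscriminantInt.natAbs + V.minimalDiscriminantInt.natAbs)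
  haveI : Fact q.Prime := ⟨hqP⟩
  have hq2 : q ≠ 2 := by omega
  have hqp : q ≠ p := by omega
  have hqr : q ≠ r := by omega
  have hΔ0 : W.minimalDiscriminantInt ≠ 0 := minimalDiscriminantInt_ne_zero W
  have hqΔ : ¬ (q : ℤ) ∣ W.minimalDiscriminantInt := by
    intro h
    have h1 : q ∣ W.minimalDiscriminantInt.natAbs := Int.natCast_dvd.mp h
    have h2 := Nat.le_of_dvd (Int.natAbs_pos.mpr hΔ0) h1
    omega
  have hqgood : W.HasGoodReductionAtPrime q := hasGoodReductionAtPrime_of_not_dvd W q hqΔ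
  have hqa' : ((q : ℤ) : ZMod r) = a := by rw [Int.cast_natCast, hqa]
  have hrq : ¬ (r : ℤ) ∣ (q : ℤ) := by
    intro h
    have h' : ((q : ℤ) : ZMod r) = 0 := (ZMod.intCast_zmod_eq_zero_iff_dvd _ r).mpr h
    rw [hqa'] at h'
    exact ha0 h'
  -- the twist parameter `d = r* q`, square-free, prime to `p`
  set d : ℤ := (-1 : ℤ) ^ (r / 2) * r * q with hd_def
  have hd : Squarefree d := squarefree_pStar_mul_prime hrP hqP hqr
  have hdq : (d : ℚ) = ps * ((q : ℤ) : ℚ) := by rw [hd_def, hps]; push_cast; ring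
  have hd0 : (d : ℚ) ≠ 0 := by exact_mod_cast hd.ne_zero
  have hq0 : ((q : ℤ) : ℚ) ≠ 0 := by exact_mod_cast hqP.ne_zero
  have hpZ : Prime (p : ℤ) := Nat.prime_iff_prime_int.mp hpP
  have hp2d : ¬ (p : ℤ) ∣ 2 * d := by
    intro h
    rcases hpZ.dvd_or_dvd h with h2 | hpd
    · exact hp ((Nat.prime_dvd_prime_iff_eq hpP Nat.prime_two).mp (by exact_mod_cast h2))
    · rw [hd_def] at hpd
      rcases hpZ.dvd_or_dvd hpd with h1 | hq'
      · rcases hpZ.dvd_or_dvd h1 with hu | hr'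
        · have hu' := (Prime.dvd_of_dvd_pow hpZ hu)
          have : (p : ℤ) ∣ 1 := (dvd_neg).mp hu'
          exact hpP.one_lt.ne' (by exact_mod_cast Int.eq_one_of_dvd_one (by positivity) this)
        · exact hrp ((Nat.prime_dvd_prime_iff_eq hpP hrP).mp (by exact_mod_cast hr')).symm
      · exact hqp ((Nat.prime_dvd_prime_iff_eq hpP hqP).mp (by exact_mod_cast hq')).symm
  have hqd : (q : ℤ) ∣ d := ⟨(-1 : ℤ) ^ (r / 2) * r, by rw [hd_def]; ring⟩
  -- a globally minimal model `W'` of `V^{(q)} ≅ W^{(d)}`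
  haveI := V.isElliptic_quadraticTwist hq0
  obtain ⟨W', hE', hM', C₂, hC₂⟩ := exists_isGloballyMinimal_smul_eq_quadraticTwist V hq0
  have hVq : V.quadraticTwist ((q : ℤ) : ℚ) =
      (⟨C₁.u, ((q : ℤ) : ℚ) * C₁.r, 0, 0⟩ : VariableChange ℚ) • W.quadraticTwist (d : ℚ) := by
    rw [hC₁, quadraticTwist_smul, quadraticTwist_quadraticTwist, hdq]
  set D : VariableChange ℚ := ⟨C₁.u, ((q : ℤ) : ℚ) * C₁.r, 0, 0⟩ with hD
  have hC : (D⁻¹ * C₂) • W' = W.quadraticTwist (d : ℚ) := by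
    rw [mul_smul, hC₂, hVq, inv_smul_smul]
  haveI := W.isElliptic_quadraticTwist hd0
  have hW' : W' = (D⁻¹ * C₂)⁻¹ • W.quadraticTwist (d : ℚ) := by rw [← hC, inv_smul_smul]
  -- the local conclusion at `r`
  obtain ⟨hm', hns', hord'⟩ := hloc q hqa' hrq W' C₂ hC₂
  refine ⟨q, ⟨hqP⟩, W', hE', hM', D⁻¹ * C₂, hq2, hqp, hqr, hC, ?_, ?_, ?_, ?_, hrp, hm', hns',
    by rw [hord']; exact hordV⟩
  · exact ⟨goodSS_of_smul_eq_quadraticTwist W W' p hX.1 hd hC hp2d,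
      not_semistable_of_smul_eq_quadraticTwist_of_odd_prime_dvd W W' hd hC hq2 hqd hqgood⟩
  · have hj' : W'.j = W.j := j_eq_of_model_smul_eq_quadraticTwist hd0 hC
    exact fun h ↦ hcm ((hasCM_iff_of_j_eq hj').mp h)
  · rw [frobeniusTrace_of_smul_eq_quadraticTwist W W' p hd hC hp2d hX.1.1, hap, mul_zero]
  · have h1 :=
      Summit.BirchSwinnertonDyer.Rank1Residual.GaloisImage.hasSurjectiveModNGaloisRep_pow_iff_of_model_twist
        W p hd0 (Wd := W') ⟨(D⁻¹ * C₂)⁻¹, hW'.symm⟩ 1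
    rw [pow_one] at h1
    exact h1.mpr hs

/-- **Modulo the Fouquet–Wan binder: a potentially multiplicative `j`-witness gives a quadratic twist
satisfying Kobayashi's main conjecture, both signs.** With `W`, `p`, `r` as in
`exists_twist_on_fwLocus_of_potMult`: IF `FouquetWan2021_thm451_via_kobayashi74_OPEN` holds (`hFW`,
UNREFEREED), the twist `W'` on the locus satisfies `KobayashiMainConjecture W' p ε` for every `ε`
(`X7.kobayashiMainConjecture_of_thm451_OPEN_of_surj`). No descent to `W` is claimed. CONDITIONAL;
closes nothing. [claim: FouquetWan2021, status: under-review]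
[cite: Kobayashi2003, Thm. 7.4 (p. 13) and Conjecture (p. 2)] -/
theorem exists_twist_kobayashiMainConjecture_of_thm451_OPEN_of_potMult
    (hFW : FouquetWan2021_thm451_via_kobayashi74_OPEN) (p : ℕ) [Fact p.Prime] (hp : p ≠ 2)
    (hX : ClassX7 W p) (hcm : ¬ W.HasCM) (hap : W.frobeniusTrace p = 0) (hs : Surj W p)
    {r : ℕ} [Fact r.Prime] (hr2 : r ≠ 2) (hrp : r ≠ p)
    (hpm : Summit.BirchSwinnertonDyer.Rank1Residual.AdditivePotMult.PotMult W r)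
    (hj : ¬ (p : ℤ) ∣ padicValRat r W.j) :
    ∃ (q : ℕ) (_ : Fact q.Prime) (W' : WeierstrassCurve ℚ) (_ : W'.IsElliptic) (_ : W'.IsGloballyMinimal)
      (C : VariableChange ℚ), q ≠ 2 ∧ q ≠ p ∧ q ≠ r ∧
      C • W' = W.quadraticTwist ((((-1 : ℤ) ^ (r / 2) * r * q : ℤ)) : ℚ) ∧
      ∀ ε : ℤˣ, KobayashiMainConjecture W' p ε := by
  obtain ⟨q, hq, W', hE', hM', C, hq2, hqp, hqr, hC, hX', -, hap', hs', hloc⟩ :=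
    exists_twist_on_fwLocus_of_potMult W p hp hX hcm hap hs hr2 hrp hpm hj
  exact ⟨q, hq, W', hE', hM', C, hq2, hqp, hqr, hC,
    X7.kobayashiMainConjecture_of_thm451_OPEN_of_surj W' p hFW hp hX' hap' hs' ⟨r, inferInstance, hloc⟩⟩

end PotMultTwist

/-! ### §7 The `j`-witness form: `stub_offFwLocus` hypotheses + an odd `j`-witness ⟹ a twist on the locus;
no `j`-witness ⟹ no twist on the locus -/

section JWitness

variable (W : WeierstrassCurve ℚ) [W.IsElliptic] [W.IsGloballyMinimal]

/-- **`stub_offFwLocus` hypotheses + an ODD `j`-witness ⟹ a quadratic twist ON the Fouquet–Wan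
locus.** For `W` globally minimal, `p` odd, `ClassX7 W p`, no CM, `a_p = 0`, `ρ̄_{E,p}` onto, OFF the
FW locus (the registered stub's negated-locus hypothesis, verbatim), and an odd prime `r ≠ p` with
`ord_r j(W) < 0` and `p ∤ ord_r j(W)`: there are `d ∈ ℤ ∖ {0}` and a globally minimal model `W'` of
`W^{(d)}` that is an X7 pair at `p` with `a_p = 0`, `ρ̄` onto, no CM and satisfies the LOCUS hypothesis
of `stub_fwLocus`. Trichotomy at `r`: good reduction is excluded (`ord_r j ≥ 0`,
`EisensteinPrimes.padicValRat_j_eq_of_good`); multiplicative ⟹ `p ∤ ord_r Δ_min`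
(`dvd_padicValInt_minimalDiscriminantInt_iff_of_mult`) and, `W` being off the locus, SPLIT ⟹ gen 3's
`exists_twist_on_fwLocus_of_split_ram` (`d = q` prime); additive ⟹ `PotMult W r` ⟹
`exists_twist_on_fwLocus_of_potMult` (`d = r*·q`). A THEOREM; nothing about Kobayashi's conjecture is
asserted. [cite: SilvermanATAEC1994, V.5.3] [cite: SilvermanAEC2009, VII.5 Prop. 5.1 and X.5 Cor. 5.4] -/
theorem exists_twist_on_fwLocus_of_offFwLocus_of_jWitness_odd (p : ℕ) [Fact p.Prime] (hp : p ≠ 2)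
    (hX : ClassX7 W p) (hcm : ¬ W.HasCM) (hap : W.frobeniusTrace p = 0) (hs : Surj W p)
    (hoff : ¬ (∃ ℓ : ℕ, ∃ _ : Fact ℓ.Prime, ℓ ≠ p ∧ W.HasMultiplicativeReductionAtPrime ℓ ∧
      ¬ W.HasSplitMultiplicativeReductionAtPrime ℓ ∧ ¬ p ∣ padicValInt ℓ W.minimalDiscriminantInt))
    {r : ℕ} [Fact r.Prime] (hr2 : r ≠ 2) (hrp : r ≠ p) (hjneg : padicValRat r W.j < 0)
    (hj : ¬ (p : ℤ) ∣ padicValRat r W.j) :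
    ∃ (d : ℤ) (W' : WeierstrassCurve ℚ) (_ : W'.IsElliptic) (_ : W'.IsGloballyMinimal)
      (C : VariableChange ℚ), d ≠ 0 ∧ C • W' = W.quadraticTwist (d : ℚ) ∧
      ClassX7 W' p ∧ ¬ W'.HasCM ∧ W'.frobeniusTrace p = 0 ∧ Surj W' p ∧
      (∃ ℓ : ℕ, ∃ _ : Fact ℓ.Prime, ℓ ≠ p ∧ W'.HasMultiplicativeReductionAtPrime ℓ ∧
        ¬ W'.HasSplitMultiplicativeReductionAtPrime ℓ ∧ ¬ p ∣ padicValInt ℓ W'.minimalDiscriminantInt) := by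
  have hrP : r.Prime := Fact.out
  by_cases hmult : W.HasMultiplicativeReductionAtPrime r
  · -- multiplicative: a (ram) prime, split because `W` is off the locus
    have hordr : ¬ p ∣ padicValInt r W.minimalDiscriminantInt := by
      rw [Summit.BirchSwinnertonDyer.Rank1Residual.AdditivePotMult.dvd_padicValInt_minimalDiscriminantInt_iff_of_mult
        W r hmult p]
      exact hj
    have hsplit : W.HasSplitMultiplicativeReductionAtPrime r := by
      by_contra hns
      exact hoff ⟨r, inferInstance, hrp, hmult, hns, hordr⟩
    obtain ⟨q, hq, W', hE', hM', C, -, -, hC, hX', hcm', hap', hs', hloc⟩ :=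
      exists_twist_on_fwLocus_of_split_ram W p hp hX hcm hap hs hr2 hrp hmult hsplit hordr
    exact ⟨q, W', hE', hM', C, by exact_mod_cast hq.out.ne_zero, hC, hX', hcm', hap', hs',
      r, inferInstance, hloc⟩
  · -- not multiplicative: not good either (`ord_r j < 0`), hence additive potentially multiplicative
    have hgood : ¬ W.HasGoodReductionAtPrime r := by
      intro hg
      have h := Summit.BirchSwinnertonDyer.Rank1Residual.EisensteinPrimes.padicValRat_j_eq_of_good W r hg
      have : (0 : ℤ) ≤ padicValRat r W.j := by rw [h]; positivity
      exact absurd hjneg (not_lt.mpr this)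
    have hpm : Summit.BirchSwinnertonDyer.Rank1Residual.AdditivePotMult.PotMult W r :=
      ⟨⟨hgood, hmult⟩, hjneg⟩
    obtain ⟨q, hq, W', hE', hM', C, -, -, hqr, hC, hX', hcm', hap', hs', hloc⟩ :=
      exists_twist_on_fwLocus_of_potMult W p hp hX hcm hap hs hr2 hrp hpm hj
    exact ⟨(-1 : ℤ) ^ (r / 2) * r * q, W', hE', hM', C,
      (squarefree_pStar_mul_prime hrP hq.out hqr).ne_zero, hC, hX', hcm', hap', hs',
      r, inferInstance, hloc⟩

/-- **Modulo the Fouquet–Wan binder: `stub_offFwLocus` hypotheses + an odd `j`-witness ⟹ Kobayashi's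
main conjecture for a quadratic twist, both signs.** CONDITIONAL; no descent to `W` is claimed.
[claim: FouquetWan2021, status: under-review] [cite: Kobayashi2003, Thm. 7.4 (p. 13) and Conjecture (p. 2)] -/
theorem exists_twist_kobayashiMainConjecture_of_thm451_OPEN_of_offFwLocus_of_jWitness_odd
    (hFW : FouquetWan2021_thm451_via_kobayashi74_OPEN) (p : ℕ) [Fact p.Prime] (hp : p ≠ 2)
    (hX : ClassX7 W p) (hcm : ¬ W.HasCM) (hap : W.frobeniusTrace p = 0) (hs : Surj W p)
    (hoff : ¬ (∃ ℓ : ℕ, ∃ _ : Fact ℓ.Prime, ℓ ≠ p ∧ W.HasMultiplicativeReductionAtPrime ℓ ∧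
      ¬ W.HasSplitMultiplicativeReductionAtPrime ℓ ∧ ¬ p ∣ padicValInt ℓ W.minimalDiscriminantInt))
    {r : ℕ} [Fact r.Prime] (hr2 : r ≠ 2) (hrp : r ≠ p) (hjneg : padicValRat r W.j < 0)
    (hj : ¬ (p : ℤ) ∣ padicValRat r W.j) :
    ∃ (d : ℤ) (W' : WeierstrassCurve ℚ) (_ : W'.IsElliptic) (_ : W'.IsGloballyMinimal)
      (C : VariableChange ℚ), d ≠ 0 ∧ C • W' = W.quadraticTwist (d : ℚ) ∧
      ∀ ε : ℤˣ, KobayashiMainConjecture W' p ε := by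
  obtain ⟨d, W', hE', hM', C, hd0, hC, hX', -, hap', hs', hloc⟩ :=
    exists_twist_on_fwLocus_of_offFwLocus_of_jWitness_odd W p hp hX hcm hap hs hoff hr2 hrp hjneg hj
  exact ⟨d, W', hE', hM', C, hd0, hC,
    X7.kobayashiMainConjecture_of_thm451_OPEN_of_surj W' p hFW hp hX' hap' hs' hloc⟩

omit [W.IsGloballyMinimal] in
/-- **No `j`-witness ⟹ NO quadratic twist is on the Fouquet–Wan locus.** If every prime `q ≠ p` with
`ord_q j(W) < 0` has `p ∣ ord_q j(W)`, then for every `d ∈ ℚ^×` and every globally minimal `ℚ`-model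
`Wd` of `W^{(d)}`, `Wd` does NOT satisfy the locus hypothesis of `stub_fwLocus` (indeed not even (ram):
tree `AdditivePotMult.not_ram_model_twist_of_forall_dvd`). The no-go half of «one twist from the locus
⟺ a `j`-witness»; on the cell's window these are the 10 D ∪ E pairs with no `j`-witness.
[cite: SilvermanAEC2009, VII.5 Prop. 5.1(b) and X.5 Cor. 5.4] -/
theorem not_fwLocus_model_twist_of_forall_dvd (p : ℕ) [Fact p.Prime]
    (hall : ∀ q : ℕ, q.Prime → q ≠ p → padicValRat q W.j < 0 → (p : ℤ) ∣ padicValRat q W.j)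
    {d : ℚ} (hd : d ≠ 0) (Wd : WeierstrassCurve ℚ) [Wd.IsElliptic] [Wd.IsGloballyMinimal]
    (hWd : ∃ C : VariableChange ℚ, C • W.quadraticTwist d = Wd) :
    ¬ (∃ ℓ : ℕ, ∃ _ : Fact ℓ.Prime, ℓ ≠ p ∧ Wd.HasMultiplicativeReductionAtPrime ℓ ∧
      ¬ Wd.HasSplitMultiplicativeReductionAtPrime ℓ ∧ ¬ p ∣ padicValInt ℓ Wd.minimalDiscriminantInt) := by
  rintro ⟨ℓ, hℓ, hℓp, hmult, -, hord⟩
  exact Summit.BirchSwinnertonDyer.Rank1Residual.AdditivePotMult.not_ram_model_twist_of_forall_dvd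
    hall hd Wd hWd ⟨ℓ, hℓ, hℓp, hmult, hord⟩

end JWitness

end Summit.BirchSwinnertonDyer.BirchSwinnertonDyer.Theorems

end
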